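import Literature.GroupTheory.CombinatorialGroupTheory.BinaryProductChainStructure
import Mathlib.Logic.Relation
import HarnessLib

/-!
# The partner graph of a cyclic product: levels, adjacency, components, types

Topic `Literature/GroupTheory/CombinatorialGroupTheory`.  Continuation of
`BinaryProductChainStructure.lean` (Zieschang–Vogt–Coldewey, *Surfaces and Planar Discontinuous
Groups*, LNM 835 (1980), §5.3, proof of Thm. 5.3.2: *"By going from a letter alternately to
formal and cancelling partners we obtain a chain of symbols"*).  For a cyclically Nielsen reduced
cyclic product `U` with a pairing `bar`, the **partner graph** has the slots as vertices, an
`f`-edge `{σ, fpartner σ}` at every slot and a `c`-edge `{σ, cget σ}` at every head or tail slot;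
every head or tail slot has degree `2`, every kernel slot degree `1`.  Here:

* the **level** `level U σ = min p (|U_k| - 1 - p)` of a slot `σ = (k, p)` (its position for a
  head slot, its depth from the end for a tail slot) is invariant under both partners
  (`IsPairing.level_fpartner`, `IsTailSlot.level_cget`, `IsHeadSlot.level_cget`); the formal
  partner of a tail slot is never a tail slot and that of a head slot never a head slot;
* adjacency `Adj` and the component relation `SameComp` (its reflexive-transitive closure, an
  equivalence relation on slots); **the level is constant on components** (`SameComp.level_eq`);
* the **type** `slotType` (a `2`-colouring: tail slots and kernel slots facing a head slot have
  type `X = true`, head slots and kernel slots facing a tail slot type `Y = false`, two kernel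
  slots facing each other are coloured by comparing factor indices): every edge joins opposite
  types, so along a component letters are constant on each type and inverse on opposite types
  (`SameComp.slotLetter_eq`).

Components as finite sets, chains and closed walks are in `BinaryProductComponents.lean`, the
crossing parity in `BinaryProductEdges.lean` and `BinaryProductParity.lean`.

## References

* H. Zieschang, E. Vogt, H.-D. Coldewey, *Surfaces and Planar Discontinuous Groups*, LNM 835
  (1980), §5.3 (proof of Thm. 5.3.2). [ZieschangVogtColdewey1980]
* H. Zieschang, *Alternierende Produkte in freien Gruppen*, Abh. Math. Sem. Univ. Hamburg 27
  (1964) 13–31. [Zieschang1964]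
-/

namespace Literature.GroupTheory.CombinatorialGroupTheory

open List

namespace CycFactors

variable {α : Type*}

/-! ## Levels -/

section level

/-- The **level** of a slot `(k, p)`: `min p (|U_k| - 1 - p)`, the distance to the nearer end of
its factor — the position `p` for a head slot, the depth `|U_k| - 1 - p` from the end for a tail
slot (ZVC's chains of "extreme letters" stay at one depth).
[cite: ZieschangVogtColdewey1980, proof of Thm. 5.3.2] -/
def level (U : List (List (α × Bool))) (σ : ℕ × ℕ) : ℕ :=
  min σ.2 ((fac U σ.1).length - 1 - σ.2)

variable {U : List (List (α × Bool))} {bar : ℕ → ℕ} {σ : ℕ × ℕ}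

/-- **The formal partner preserves the level** (it exchanges position and depth inside two
words of the same length). [cite: ZieschangVogtColdewey1980, proof of Thm. 5.3.2] -/
theorem IsPairing.level_fpartner (hb : IsPairing U bar) (hσ : IsSlot U σ) :
    level U (fpartner U bar σ) = level U σ := by
  obtain ⟨h1, h2⟩ := hσ
  simp only [level, fpartner, hb.length_fac_bar h1]
  omega

variable [DecidableEq α]

/-- The level of a tail slot is its depth from the end of the factor. [folklore] -/
theorem IsTailSlot.level_eq (h : CycNielsen U) (ht : IsTailSlot U σ) :
    level U σ = (fac U σ.1).length - 1 - σ.2 := by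
  have h1 := (h.pair σ.1).1
  have h2 := ht.2
  have h3 := ht.1.2
  unfold level
  omega

/-- The level of a head slot is its position. [folklore] -/
theorem IsHeadSlot.level_eq (h : CycNielsen U) (hh : IsHeadSlot U σ) : level U σ = σ.2 := by
  have h1 := (h.pair (cpred U σ.1)).2
  rw [fac_cpred_succ] at h1
  have h2 := hh.2
  unfold level
  omega

/-- On head and tail slots the level is given by the case formula "depth for tail slots,
position otherwise". [folklore] -/
theorem level_eq_ite (h : CycNielsen U) (hU : U ≠ []) (hσ : IsSlot U σ) (hk : ¬ IsKernelSlot U σ) :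
    level U σ = if (fac U σ.1).length ≤ σ.2 + jc U σ.1 then (fac U σ.1).length - 1 - σ.2
      else σ.2 := by
  rcases hσ.head_or_tail hk with hh | ht
  · rw [if_neg (fun ht => h.not_isHeadSlot_of_isTailSlot hU ⟨hσ, ht⟩ hh), hh.level_eq h]
  · rw [if_pos ht.2, ht.level_eq h]

/-- Twice the level of a head slot is less than the length of its factor. [folklore] -/
theorem IsHeadSlot.two_mul_level_lt (h : CycNielsen U) (hh : IsHeadSlot U σ) :
    2 * level U σ < (fac U σ.1).length := by
  have h1 := (h.pair (cpred U σ.1)).2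
  rw [fac_cpred_succ] at h1
  have h2 := hh.2
  rw [hh.level_eq h]
  omega

/-- Twice the level of a tail slot is less than the length of its factor. [folklore] -/
theorem IsTailSlot.two_mul_level_lt (h : CycNielsen U) (ht : IsTailSlot U σ) :
    2 * level U σ < (fac U σ.1).length := by
  have h1 := (h.pair σ.1).1
  have h2 := ht.2
  have h3 := ht.1.2
  rw [ht.level_eq h]
  omega

/-- **The formal partner of a tail slot is not a tail slot** (its depth would exceed half the
word). [cite: ZieschangVogtColdewey1980, proof of Thm. 5.3.2] -/
theorem IsTailSlot.not_isTailSlot_fpartner (h : CycNielsen U) (hb : IsPairing U bar)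
    (ht : IsTailSlot U σ) : ¬ IsTailSlot U (fpartner U bar σ) := by
  intro ht'
  obtain ⟨⟨hk, hp⟩, h2⟩ := ht
  have e := hb.length_fac_bar hk
  have h3 := ht'.2
  simp only [fpartner] at h3
  rw [e] at h3
  have h4 := (h.pair (bar σ.1)).1
  rw [e] at h4
  have h5 := (h.pair σ.1).1
  omega

/-- **The formal partner of a head slot is not a head slot.**
[cite: ZieschangVogtColdewey1980, proof of Thm. 5.3.2] -/
theorem IsHeadSlot.not_isHeadSlot_fpartner (h : CycNielsen U) (hb : IsPairing U bar)
    (hh : IsHeadSlot U σ) : ¬ IsHeadSlot U (fpartner U bar σ) := by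
  intro hh'
  obtain ⟨⟨hk, hp⟩, h2⟩ := hh
  have e := hb.length_fac_bar hk
  have h3 := hh'.2
  simp only [fpartner] at h3
  have h4 := (h.pair (cpred U (bar σ.1))).2
  rw [fac_cpred_succ, e] at h4
  have h5 := (h.pair (cpred U σ.1)).2
  rw [fac_cpred_succ] at h5
  omega

/-- The formal partner of a tail slot is a head slot or a kernel slot. [folklore] -/
theorem IsTailSlot.fpartner_head_or_kernel (h : CycNielsen U) (hb : IsPairing U bar)
    (ht : IsTailSlot U σ) :
    IsHeadSlot U (fpartner U bar σ) ∨ IsKernelSlot U (fpartner U bar σ) := by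
  rcases (hb.isSlot_fpartner ht.1).trichotomy with hk | hh | ht'
  · exact Or.inr hk
  · exact Or.inl hh
  · exact absurd ht' (ht.not_isTailSlot_fpartner h hb)

/-- The formal partner of a head slot is a tail slot or a kernel slot. [folklore] -/
theorem IsHeadSlot.fpartner_tail_or_kernel (h : CycNielsen U) (hb : IsPairing U bar)
    (hh : IsHeadSlot U σ) :
    IsTailSlot U (fpartner U bar σ) ∨ IsKernelSlot U (fpartner U bar σ) := by
  rcases (hb.isSlot_fpartner hh.1).trichotomy with hk | hh' | ht
  · exact Or.inr hk
  · exact absurd hh' (hh.not_isHeadSlot_fpartner h hb)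
  · exact Or.inl ht

/-- **The cancelling partner of a tail slot has the same level** (it is the head slot of the
successor at the same depth). [cite: ZieschangVogtColdewey1980, proof of Thm. 5.3.2] -/
theorem IsTailSlot.level_cget (h : CycNielsen U) (ht : IsTailSlot U σ) :
    level U (cget U σ) = level U σ := by
  rw [ht.level_eq h, ht.isHeadSlot_cget.level_eq h, ht.cget_eq]

/-- **The cancelling partner of a head slot has the same level.**
[cite: ZieschangVogtColdewey1980, proof of Thm. 5.3.2] -/
theorem IsHeadSlot.level_cget (h : CycNielsen U) (hU : U ≠ []) (hh : IsHeadSlot U σ) :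
    level U (cget U σ) = level U σ := by
  rw [hh.level_eq h, (hh.isTailSlot_cget h hU).level_eq h, hh.cget_eq h hU]
  simp only
  rw [fac_mod]
  have h1 := hh.2
  have h2 := jc_le_length U (cpred U σ.1)
  omega

/-- The cancelling partner of a head or tail slot has the same level. [folklore] -/
theorem CycNielsen.level_cget (h : CycNielsen U) (hU : U ≠ []) (hσ : IsSlot U σ)
    (hk : ¬ IsKernelSlot U σ) : level U (cget U σ) = level U σ := by
  rcases hσ.head_or_tail hk with hh | ht
  · exact hh.level_cget h hU
  · exact ht.level_cget h

end level

/-! ## Adjacency in the partner graph, components -/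

section adjacency

variable [DecidableEq α]

/-- **Adjacency in the partner graph**: `τ` is the formal partner of the slot `σ`, or `σ` is a
head or tail slot and `τ` is its cancelling partner.
[cite: ZieschangVogtColdewey1980, proof of Thm. 5.3.2] -/
def Adj (U : List (List (α × Bool))) (bar : ℕ → ℕ) (σ τ : ℕ × ℕ) : Prop :=
  IsSlot U σ ∧ (τ = fpartner U bar σ ∨ (¬ IsKernelSlot U σ ∧ τ = cget U σ))

/-- **Same component of the partner graph**: the reflexive-transitive closure of adjacency (ZVC's
chains, open or closed). [cite: ZieschangVogtColdewey1980, proof of Thm. 5.3.2] -/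
def SameComp (U : List (List (α × Bool))) (bar : ℕ → ℕ) : ℕ × ℕ → ℕ × ℕ → Prop :=
  Relation.ReflTransGen (Adj U bar)

variable {U : List (List (α × Bool))} {bar : ℕ → ℕ} {σ τ ρ : ℕ × ℕ}

/-- A slot is adjacent to its formal partner. [folklore] -/
theorem adj_fpartner (hσ : IsSlot U σ) : Adj U bar σ (fpartner U bar σ) := ⟨hσ, Or.inl rfl⟩

/-- A head or tail slot is adjacent to its cancelling partner. [folklore] -/
theorem adj_cget (hσ : IsSlot U σ) (hk : ¬ IsKernelSlot U σ) : Adj U bar σ (cget U σ) :=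
  ⟨hσ, Or.inr ⟨hk, rfl⟩⟩

/-- A slot is adjacent to its cancelling partner, `cpartner` form. [folklore] -/
theorem adj_of_cpartner_eq_some (hσ : IsSlot U σ) (hc : cpartner U σ = some τ) : Adj U bar σ τ := by
  have hk : ¬ IsKernelSlot U σ := fun hk => by rw [cpartner_of_isKernelSlot hk] at hc; cases hc
  refine ⟨hσ, Or.inr ⟨hk, ?_⟩⟩
  rw [cget, hc, Option.getD_some]

/-- Adjacency, `cpartner` form. [folklore] -/
theorem adj_iff : Adj U bar σ τ ↔ IsSlot U σ ∧ (τ = fpartner U bar σ ∨ cpartner U σ = some τ) := by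
  constructor
  · rintro ⟨hσ, h | ⟨hk, rfl⟩⟩
    · exact ⟨hσ, Or.inl h⟩
    · exact ⟨hσ, Or.inr (cpartner_eq_some_cget hσ hk)⟩
  · rintro ⟨hσ, h | h⟩
    · exact ⟨hσ, Or.inl h⟩
    · exact adj_of_cpartner_eq_some hσ h

/-- The left end of an edge is a slot. [folklore] -/
theorem Adj.isSlot_left (ha : Adj U bar σ τ) : IsSlot U σ := ha.1

/-- The right end of an edge is a slot. [folklore] -/
theorem Adj.isSlot_right (h : CycNielsen U) (hU : U ≠ []) (hb : IsPairing U bar)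
    (ha : Adj U bar σ τ) : IsSlot U τ := by
  obtain ⟨hσ, rfl | ⟨hk, rfl⟩⟩ := ha
  · exact hb.isSlot_fpartner hσ
  · exact (h.cget_spec hU hσ hk).1

/-- Adjacency is symmetric. [folklore] -/
theorem Adj.symm (h : CycNielsen U) (hU : U ≠ []) (hb : IsPairing U bar) (ha : Adj U bar σ τ) :
    Adj U bar τ σ := by
  obtain ⟨hσ, rfl | ⟨hk, rfl⟩⟩ := ha
  · exact ⟨hb.isSlot_fpartner hσ, Or.inl (hb.fpartner_fpartner hσ).symm⟩
  · obtain ⟨h1, h2, h3⟩ := h.cget_spec hU hσ hk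
    exact ⟨h1, Or.inr ⟨h2, h3.symm⟩⟩

/-- Every slot is on its own component. [folklore] -/
theorem sameComp_refl (σ : ℕ × ℕ) : SameComp U bar σ σ := Relation.ReflTransGen.refl

/-- Adjacent slots are on the same component. [folklore] -/
theorem Adj.sameComp (ha : Adj U bar σ τ) : SameComp U bar σ τ := Relation.ReflTransGen.single ha

/-- `SameComp` is transitive. [folklore] -/
theorem SameComp.trans (h1 : SameComp U bar σ τ) (h2 : SameComp U bar τ ρ) : SameComp U bar σ ρ :=
  Relation.ReflTransGen.trans h1 h2

/-- Extending a component path by an edge. [folklore] -/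
theorem SameComp.tail (h1 : SameComp U bar σ τ) (h2 : Adj U bar τ ρ) : SameComp U bar σ ρ :=
  Relation.ReflTransGen.tail h1 h2

/-- `SameComp` is symmetric. [folklore] -/
theorem SameComp.symm (h : CycNielsen U) (hU : U ≠ []) (hb : IsPairing U bar)
    (hs : SameComp U bar σ τ) : SameComp U bar τ σ := by
  induction hs with
  | refl => exact sameComp_refl _
  | tail _ hbc ih => exact Relation.ReflTransGen.head (hbc.symm h hU hb) ih

/-- A component path from a slot ends at a slot. [folklore] -/
theorem SameComp.isSlot (h : CycNielsen U) (hU : U ≠ []) (hb : IsPairing U bar)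
    (hs : SameComp U bar σ τ) (hσ : IsSlot U σ) : IsSlot U τ := by
  induction hs with
  | refl => exact hσ
  | tail _ hbc _ => exact hbc.isSlot_right h hU hb

/-- A non-trivial component path starts at a slot. [folklore] -/
theorem SameComp.isSlot_of_ne (hs : SameComp U bar σ τ) (hne : σ ≠ τ) : IsSlot U σ := by
  induction hs with
  | refl => exact (hne rfl).elim
  | @tail b c _ hbc ih =>
    by_cases he : σ = b
    · rw [he]; exact hbc.1
    · exact ih he

/-- A slot is on the component of its formal partner. [folklore] -/
theorem sameComp_fpartner (hσ : IsSlot U σ) : SameComp U bar σ (fpartner U bar σ) :=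
  (adj_fpartner hσ).sameComp

/-- A head or tail slot is on the component of its cancelling partner. [folklore] -/
theorem sameComp_cget (hσ : IsSlot U σ) (hk : ¬ IsKernelSlot U σ) : SameComp U bar σ (cget U σ) :=
  (adj_cget hσ hk).sameComp

/-- **Adjacent slots have the same level.** [cite: ZieschangVogtColdewey1980, proof of Thm. 5.3.2] -/
theorem Adj.level_eq (h : CycNielsen U) (hU : U ≠ []) (hb : IsPairing U bar) (ha : Adj U bar σ τ) :
    level U τ = level U σ := by
  obtain ⟨hσ, rfl | ⟨hk, rfl⟩⟩ := ha
  · exact hb.level_fpartner hσ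
  · exact h.level_cget hU hσ hk

/-- **The level is constant on every component of the partner graph.**
[cite: ZieschangVogtColdewey1980, proof of Thm. 5.3.2] -/
theorem SameComp.level_eq (h : CycNielsen U) (hU : U ≠ []) (hb : IsPairing U bar)
    (hs : SameComp U bar σ τ) : level U τ = level U σ := by
  induction hs with
  | refl => rfl
  | tail _ hbc ih => rw [hbc.level_eq h hU hb, ih]

end adjacency

/-! ## Types -/

section types

variable [DecidableEq α]

/-- The **type** of a slot, a `2`-colouring of the partner graph: tail slots, and kernel slots
whose formal partner is a head slot, have type `X = true`; head slots, and kernel slots whose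
formal partner is a tail slot, have type `Y = false`; two kernel slots which are formal partners
of each other get opposite types by comparing their factor indices.
[cite: ZieschangVogtColdewey1980, proof of Thm. 5.3.2] -/
def slotType (U : List (List (α × Bool))) (bar : ℕ → ℕ) (σ : ℕ × ℕ) : Bool :=
  if IsTailSlot U σ then true
  else if IsHeadSlot U σ then false
  else if IsHeadSlot U (fpartner U bar σ) then true
  else if IsTailSlot U (fpartner U bar σ) then false
  else decide (σ.1 < bar σ.1)

variable {U : List (List (α × Bool))} {bar : ℕ → ℕ} {σ τ : ℕ × ℕ}

/-- Tail slots have type `X`. [folklore] -/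
theorem IsTailSlot.slotType_eq (ht : IsTailSlot U σ) : slotType U bar σ = true := by
  rw [slotType, if_pos ht]

/-- Head slots have type `Y`. [folklore] -/
theorem IsHeadSlot.slotType_eq (h : CycNielsen U) (hU : U ≠ []) (hh : IsHeadSlot U σ) :
    slotType U bar σ = false := by
  rw [slotType, if_neg (fun ht => h.not_isHeadSlot_of_isTailSlot hU ht hh), if_pos hh]

/-- The type of a kernel slot is read off its formal partner. [folklore] -/
theorem IsKernelSlot.slotType_eq (hk : IsKernelSlot U σ) :
    slotType U bar σ = if IsHeadSlot U (fpartner U bar σ) then true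
      else if IsTailSlot U (fpartner U bar σ) then false else decide (σ.1 < bar σ.1) := by
  rw [slotType, if_neg hk.not_isTailSlot, if_neg hk.not_isHeadSlot]

/-- A kernel slot facing a head slot has type `X`. [folklore] -/
theorem IsKernelSlot.slotType_eq_true (hk : IsKernelSlot U σ) (hh : IsHeadSlot U (fpartner U bar σ)) :
    slotType U bar σ = true := by
  rw [hk.slotType_eq, if_pos hh]

/-- A kernel slot facing a tail slot has type `Y`. [folklore] -/
theorem IsKernelSlot.slotType_eq_false (h : CycNielsen U) (hU : U ≠ []) (hk : IsKernelSlot U σ)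
    (ht : IsTailSlot U (fpartner U bar σ)) : slotType U bar σ = false := by
  rw [hk.slotType_eq, if_neg (fun hh => h.not_isHeadSlot_of_isTailSlot hU ht hh), if_pos ht]

/-- **Formal partners have opposite types.** [cite: ZieschangVogtColdewey1980, proof of Thm. 5.3.2] -/
theorem slotType_fpartner (h : CycNielsen U) (hU : U ≠ []) (hb : IsPairing U bar) (hσ : IsSlot U σ) :
    slotType U bar (fpartner U bar σ) = !slotType U bar σ := by
  have hff := hb.fpartner_fpartner hσ
  rcases hσ.trichotomy with hk | hh | ht
  · rcases (hb.isSlot_fpartner hσ).trichotomy with hk' | hh' | ht'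
    · rw [hk.slotType_eq, if_neg hk'.not_isHeadSlot, if_neg hk'.not_isTailSlot, hk'.slotType_eq, hff,
        if_neg hk.not_isHeadSlot, if_neg hk.not_isTailSlot]
      simp only [fpartner, hb.bar_bar _ hσ.1]
      have hne := hb.bar_ne _ hσ.1
      rcases Nat.lt_or_gt_of_ne hne with hlt | hlt
      · simp [hlt, Nat.not_lt_of_gt hlt]
      · simp [hlt, Nat.not_lt_of_gt hlt]
    · rw [hk.slotType_eq_true hh', hh'.slotType_eq h hU]; rfl
    · rw [hk.slotType_eq_false h hU ht', ht'.slotType_eq]; rfl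
  · rw [hh.slotType_eq h hU]
    rcases hh.fpartner_tail_or_kernel h hb with ht' | hk'
    · rw [ht'.slotType_eq]; rfl
    · rw [hk'.slotType_eq_true (by rw [hff]; exact hh)]; rfl
  · rw [ht.slotType_eq]
    rcases ht.fpartner_head_or_kernel h hb with hh' | hk'
    · rw [hh'.slotType_eq h hU]; rfl
    · rw [hk'.slotType_eq_false h hU (by rw [hff]; exact ht)]; rfl

/-- **Cancelling partners have opposite types.** [cite: ZieschangVogtColdewey1980, proof of Thm. 5.3.2] -/
theorem slotType_cget (h : CycNielsen U) (hU : U ≠ []) (hσ : IsSlot U σ) (hk : ¬ IsKernelSlot U σ) :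
    slotType U bar (cget U σ) = !slotType U bar σ := by
  rcases hσ.head_or_tail hk with hh | ht
  · rw [hh.slotType_eq h hU, (hh.isTailSlot_cget h hU).slotType_eq]; rfl
  · rw [ht.slotType_eq, ht.isHeadSlot_cget.slotType_eq h hU]; rfl

/-- **Every edge of the partner graph joins opposite types.**
[cite: ZieschangVogtColdewey1980, proof of Thm. 5.3.2] -/
theorem Adj.slotType_eq (h : CycNielsen U) (hU : U ≠ []) (hb : IsPairing U bar)
    (ha : Adj U bar σ τ) : slotType U bar τ = !slotType U bar σ := by
  obtain ⟨hσ, rfl | ⟨hk, rfl⟩⟩ := ha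
  · exact slotType_fpartner h hU hb hσ
  · exact slotType_cget h hU hσ hk

/-- Every edge of the partner graph joins inverse letters. [cite: ZieschangVogtColdewey1980, proof of Thm. 5.3.2] -/
theorem Adj.slotLetter_eq [Inhabited α] (h : CycNielsen U) (hU : U ≠ []) (hb : IsPairing U bar)
    (ha : Adj U bar σ τ) : slotLetter U τ = ((slotLetter U σ).1, !(slotLetter U σ).2) := by
  obtain ⟨hσ, rfl | ⟨hk, rfl⟩⟩ := ha
  · exact hb.slotLetter_fpartner hσ
  · exact h.slotLetter_cget hU hσ hk

/-- **Letters along a component**: a slot of the component of `σ` carries the letter of `σ` if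
it has the type of `σ`, and the inverse letter otherwise (types and letters both alternate
along every edge). [cite: ZieschangVogtColdewey1980, proof of Thm. 5.3.2] -/
theorem SameComp.slotLetter_eq [Inhabited α] (h : CycNielsen U) (hU : U ≠ []) (hb : IsPairing U bar)
    (hs : SameComp U bar σ τ) :
    slotLetter U τ = if slotType U bar τ = slotType U bar σ then slotLetter U σ
      else ((slotLetter U σ).1, !(slotLetter U σ).2) := by
  induction hs with
  | refl => simp
  | tail _ hbc ih =>
    rw [hbc.slotLetter_eq h hU hb, ih, hbc.slotType_eq h hU hb]
    cases slotType U bar _ <;> cases slotType U bar σ <;> simp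

/-- The generator of the letter is constant along a component. [folklore] -/
theorem SameComp.slotLetter_fst (h : CycNielsen U) (hU : U ≠ []) (hb : IsPairing U bar)
    [Inhabited α] (hs : SameComp U bar σ τ) : (slotLetter U τ).1 = (slotLetter U σ).1 := by
  rw [hs.slotLetter_eq h hU hb]
  split_ifs <;> rfl

/-- **Slots of the same type on one component carry the same letter.**
[cite: ZieschangVogtColdewey1980, proof of Thm. 5.3.2] -/
theorem SameComp.slotLetter_eq_of_slotType_eq [Inhabited α] (h : CycNielsen U) (hU : U ≠ [])
    (hb : IsPairing U bar) (hs : SameComp U bar σ τ) (ht : slotType U bar τ = slotType U bar σ) :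
    slotLetter U τ = slotLetter U σ := by
  rw [hs.slotLetter_eq h hU hb, if_pos ht]

/-- **Slots of opposite types on one component carry inverse letters.**
[cite: ZieschangVogtColdewey1980, proof of Thm. 5.3.2] -/
theorem SameComp.slotLetter_eq_of_slotType_ne [Inhabited α] (h : CycNielsen U) (hU : U ≠ [])
    (hb : IsPairing U bar) (hs : SameComp U bar σ τ) (ht : slotType U bar τ ≠ slotType U bar σ) :
    slotLetter U τ = ((slotLetter U σ).1, !(slotLetter U σ).2) := by
  rw [hs.slotLetter_eq h hU hb, if_neg ht]

/-- On one component, the type is determined by the sign of the letter. [folklore] -/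
theorem SameComp.slotType_eq_iff [Inhabited α] (h : CycNielsen U) (hU : U ≠ []) (hb : IsPairing U bar)
    (hs : SameComp U bar σ τ) :
    slotType U bar τ = slotType U bar σ ↔ (slotLetter U τ).2 = (slotLetter U σ).2 := by
  constructor
  · intro ht; rw [hs.slotLetter_eq_of_slotType_eq h hU hb ht]
  · intro hl
    by_contra ht
    rw [hs.slotLetter_eq_of_slotType_ne h hU hb ht] at hl
    revert hl
    cases (slotLetter U σ).2 <;> simp

end types

end CycFactors

end Literature.GroupTheory.CombinatorialGroupTheory
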